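import Literature.MathematicalPhysics.QuantumFieldTheory.BalabanImbrieJaffe1984to88.BIJ88Sect4Statements

/-!
# `BalabanImbrieJaffe1984to88.BIJ88Sect3Translations` — T. Bałaban, J. Imbrie, A. Jaffe, *Effective action and cluster
properties of the abelian Higgs model*, Commun. Math. Phys. **114** (1988) 257–315 [BalabanImbrieJaffe1988]: the field
translations of the first renormalization step, (3.24)–(3.31) pp. 269–270, TYPED; the quadratic-form identity (3.25) PROVED
under its small-field hypothesis

statement-level skeleton of published theorems with citation tags; proofs where landed; nothing here is a claim about the Yang–Mills mass gap

PDF held: `paper:balaban1988-cmp114-bij-abelian-higgs-effective-action` (journal page = PDF page + 256).  Renders read as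
images (poppler ×3): PDF pp. 13–14 (journal 269–270).

CITATION HEADER (lean-in-tree rule).  Part of the lit-balaban TYPED SKELETON (HOME `run/shared/lean/pub/lit-balaban/`; rows
`C2.Eq3.24`, `C2.Eq3.25`, `C2.Eq3.27`, `C2.Eq3.28`, `C2.Eq3.29`, `C2.Eq3.30`, `C2.Eq3.31` of `HOME/lit-balaban-r18/ROWS-C2.md`;
unit `lit-balaban-r18`, gen 2).  WHAT IS REPRODUCED, verbatim, p. 269 [PDF 13]: *"We begin with a translation of the gauge field
which takes the block field v out of the δ-functions of the renormalization transformation. Thus we put u_b = u′_b u_{b′}, if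
b ∈ B^s(b′) ∩ Λ₁^{(0)*}, u′_b, otherwise. ≡ u′_b(Λ₁^{(0)*}Q^{s*}v)_b, (3.24) where the prefactor Λ₁^{(0)*} indicates that what
follows is present only for b ∈ Λ₁^{(0)*}. From the restrictions on the fields, we have that u′_b = e^{ie₀A′_b}, with |A′_b| ≦
cp(e₀) in Λ₁^{(0)*}. … The quadratic form for the gauge field in Λ₁^{(0)**} is ⟨Λ₁^{(0)**}f^{(0)}, Λ₁^{(0)**}f^{(0)}⟩ =
⟨Λ₁^{(0)**}(∂A′ + L^{−2}Q^{e*}f), Λ₁^{(0)**}(∂A′ + L^{−2}Q^{e*}f)⟩, (3.25) where f(p) = (ie₀)⁻¹ log v(p). (3.26) A second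
translation is needed to remove the term linear in A′. We put A′ = A^{(0)} − Λ₄^{(0)*}L^{−2}C^{(0)}_{loc}∂*Q^{e*}f, (3.27) … Let us
write the background gauge field in Λ₃^{(0)*} in terms of A^{(0)}. It is u = (Q^{s*}v) exp[ie₀(A^{(0)} − Λ₄^{(0)*}L^{−2}C^{(0)}_{loc}
∂*Q^{e*}f)]. (3.28)"*; p. 270 [PDF 14]: *"The expansion yields for the scalar field forms ½aL^{−2}⟨ψ − Q(u)φ, ψ − Q(u)φ⟩ +
½⟨φ, −Δ_uφ⟩ = ½aL^{−2}⟨ψ − Q(u₁)φ, ψ − Q(u₁)φ⟩ + ½⟨φ, −Δ_{u₁}φ⟩ + R^{(0)}(u₁, θ₀A^{(0)}) + Σ_□ W₁^{(0)}(□), (3.29) … Again we make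
a local translation, φ = φ^{(0)} + aL^{−2}Λ₇^{(0)}C^{(0)}_{loc}(u₁)Q*(u₁)ψ. (3.30) Neglecting terms at ∂Λ₇^{(0)} and local terms … we
obtain the basic quadratic forms in φ^{(0)} and ψ: ½⟨φ^{(0)}, (−Δ_{u₁} + aL^{−2}Q(u₁)*Q(u₁))φ^{(0)}⟩ + ½⟨Λ₈^{(0)′}ψ,
Δ^L_{1,loc}(u₁)Λ₈^{(0)′}ψ⟩. (3.31)"*.
TYPED READING (unit lattice `T₁` = a torus level `j` of `Balaban1983to89.Setup`; regions by their finite sets of sites / bonds /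
plaquettes).  The translations are DEFINITIONS (affine maps of field configurations) over the OPERATOR DATA they name: the
surface-average field `Λ₁*Q^{s*}v` as a ℂ-valued bond field `w` (its definition is [2, Chap. 2] = [BalabanImbrieJaffe1985]
(2.15)–(2.17), typed by r15 as `BIJ85Sect2SurfaceAverages.Qsstar` on an abstract geometry), the bond functions
`C^{(0)}_{loc}∂*Q^{e*}f` and site functions `C^{(0)}_{loc}(u₁)Q*(u₁)ψ` as data (`corr`), the operators `Q(u)`, `−Δ_u`,
`Δ^L_{1,loc}(u₁)` as functions of the gauge field (data).  PROVED (kernel-checked, 0 sorry): the plaquette variable is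
multiplicative (`plaqVar_mul`) and the plaquette variable of a phase field `e^{ie₀A}` is `e^{ie₀(∂A)(p)}` (`plaqVar_phase`,
`∂` = `LatticeFieldCalculus.curl 1`); the principal-branch field strength of `e^{ie₀θ}` is `θ` for `|e₀θ| < π`
(`fieldStrength_exp_of_small`); hence **(3.25)**: under `u′ = e^{ie₀A′}`, the [2] (2.19)-identity `(Q^{s*}v)(∂p) = e^{ie₀L^{−2}(Q^{e*}f)(p)}`
on `Λ₁**` taken as a HYPOTHESIS on the data `w`, and small fields, `f^{(0)} = ∂A′ + L^{−2}Q^{e*}f` pointwise on `Λ₁**`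
(`fieldStrength_u324`) and the two quadratic forms of (3.25) agree (`eq325`).  TRANSCRIPTION NOTE (T8, ROWS-C2.md): the
unnumbered display of `u₁` on p. 270 prints `exp(ie₀Λ₄*L^{−2}C^{(0)}_{loc}∂*Q^{e*}f)` with `+` where (3.28) and (4.2) give `−`;
`u1bg` is typed with (3.28)'s sign.  NOT HERE: the construction of `Q^s`, `Q^e`, `C^{(0)}_{loc}` (rows C1.Eq2.15-2.17,
C2.Eq2.9), the bound `|A′_b| ≦ cp(e₀)`, the content of `R^{(0)}`/`W₁^{(0)}` beyond their definition as the (3.29) difference.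
-/

namespace Literature.MathematicalPhysics.QuantumFieldTheory.BalabanImbrieJaffe1984to88.BIJ88Sect3Translations

open Literature.MathematicalPhysics.QuantumFieldTheory.Balaban1983to89
open scoped BigOperators
open Complex Finset

noncomputable section

variable {P : Params} {j : ℕ}

/-! ## (3.24), (3.28): the gauge-field translation and the background field -/

/-- **(3.24)** p. 269 [PDF 13], verbatim: *"u_b = u′_b u_{b′}, if b ∈ B^s(b′) ∩ Λ₁^{(0)*}, u′_b, otherwise. ≡ u′_b(Λ₁^{(0)*}Q^{s*}v)_b,
(3.24) where the prefactor Λ₁^{(0)*} indicates that what follows is present only for b ∈ Λ₁^{(0)*}"* — the translated field from the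
new variable `u′` and the surface-average field `w = Q^{s*}v` (data; [2] Chap. 2), on the bond set `Λ₁*`.
[cite: BalabanImbrieJaffe1988, (3.24) p.269] -/
def u324 (Λ₁star : Finset (PBond P j)) (u' w : PBond P j → ℂ) : PBond P j → ℂ :=
  fun b => if b ∈ Λ₁star then u' b * w b else u' b

/-- (3.24) inside `Λ₁*`: the product form. [cite: BalabanImbrieJaffe1988, (3.24) p.269] -/
theorem u324_of_mem {Λ₁star : Finset (PBond P j)} (u' w : PBond P j → ℂ) {b : PBond P j} (hb : b ∈ Λ₁star) :
    u324 Λ₁star u' w b = u' b * w b := by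
  simp [u324, hb]

/-- (3.24) outside `Λ₁*`: *"u′_b, otherwise"*. [cite: BalabanImbrieJaffe1988, (3.24) p.269] -/
theorem u324_of_not_mem {Λ₁star : Finset (PBond P j)} (u' w : PBond P j → ℂ) {b : PBond P j} (hb : b ∉ Λ₁star) :
    u324 Λ₁star u' w b = u' b := by
  simp [u324, hb]

/-- p. 269: *"we have that u′_b = e^{ie₀A′_b}"* — the phase field of a real bond function (also `u^{(0)} = exp(ie₀A^{(0)})`, p. 270).
[cite: BalabanImbrieJaffe1988, (3.24) p.269] -/
def phase (e₀ : ℝ) (A : PBond P j → ℝ) : PBond P j → ℂ := fun b => exp (I * (e₀ * A b : ℝ))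

/-- **(3.27)** p. 269 [PDF 13], verbatim: *"A second translation is needed to remove the term linear in A′. We put A′ = A^{(0)} −
Λ₄^{(0)*}L^{−2}C^{(0)}_{loc}∂*Q^{e*}f, (3.27)"* — over the bond function `corr = C^{(0)}_{loc}∂*Q^{e*}f` (data) and the bond set `Λ₄*`.
[cite: BalabanImbrieJaffe1988, (3.27) p.269] -/
def Aprime327 (Λ₄star : Finset (PBond P j)) (L : ℝ) (A0 corr : PBond P j → ℝ) : PBond P j → ℝ :=
  fun b => A0 b - if b ∈ Λ₄star then L ^ (-(2 : ℤ)) * corr b else 0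

/-- **(3.28)** p. 269 [PDF 13], verbatim: *"Let us write the background gauge field in Λ₃^{(0)*} in terms of A^{(0)}. It is
u = (Q^{s*}v) exp[ie₀(A^{(0)} − Λ₄^{(0)*}L^{−2}C^{(0)}_{loc}∂*Q^{e*}f)]. (3.28)"* — `w = Q^{s*}v` times the phase of (3.27)'s `A′`.
[cite: BalabanImbrieJaffe1988, (3.28) p.269] -/
def u328 (w : PBond P j → ℂ) (e₀ : ℝ) (Λ₄star : Finset (PBond P j)) (L : ℝ) (A0 corr : PBond P j → ℝ) : PBond P j → ℂ :=
  fun b => w b * phase e₀ (Aprime327 Λ₄star L A0 corr) b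

/-- (3.28) IS (3.24) with `u′ = e^{ie₀A′}` on the bonds of `Λ₁*` (where the factor `Q^{s*}v` is present).
[cite: BalabanImbrieJaffe1988, (3.28) p.269] -/
theorem u328_eq_u324 {Λ₁star : Finset (PBond P j)} (w : PBond P j → ℂ) (e₀ : ℝ) (Λ₄star : Finset (PBond P j)) (L : ℝ)
    (A0 corr : PBond P j → ℝ) {b : PBond P j} (hb : b ∈ Λ₁star) :
    u328 w e₀ Λ₄star L A0 corr b = u324 Λ₁star (phase e₀ (Aprime327 Λ₄star L A0 corr)) w b := by
  rw [u324_of_mem _ _ hb, u328, mul_comm]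

/-- p. 270 [PDF 14], the background gauge field of the first step (zeroth order in `θ₀A^{(0)}`), verbatim: *"u₁ = (Λ₁^{(0)*}Q^{s*}v)
(Λ₆^{(0)*c}u^{(0)}) exp(ie₀Λ₄^{(0)*}L^{−2}C^{(0)}_{loc}∂*Q^{e*}f). Here u^{(0)} = exp(ie₀A^{(0)})."* — typed with the SIGN OF (3.28)/(4.2)
in the last exponential (`−`; the display prints `+`, transcription note T8): outside `Λ₆*` the full phase `e^{ie₀A^{(0)}}` is kept,
inside it is dropped (expanded as an interaction). [cite: BalabanImbrieJaffe1988, (3.28) p.270] -/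
def u1bg (Λ₁star Λ₄star Λ₆star : Finset (PBond P j)) (w : PBond P j → ℂ) (e₀ L : ℝ) (A0 corr : PBond P j → ℝ) :
    PBond P j → ℂ :=
  fun b => (if b ∈ Λ₁star then w b else 1) * (if b ∈ Λ₆star then 1 else phase e₀ A0 b) *
    exp (-(I * (e₀ * (if b ∈ Λ₄star then L ^ (-(2 : ℤ)) * corr b else 0) : ℝ)))

/-! ## (3.25): the gauge-field quadratic form after the translation — PROVED under the small-field hypothesis -/

/-- kernel: the plaquette variable is multiplicative in the bond field. [cite: BalabanImbrieJaffe1988, (3.24) p.269] -/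
theorem plaqVar_mul (u w : PBond P j → ℂ) (p : Plaq P j) :
    BIJ88Sect3Statements.plaqVar (fun b => u b * w b) p = BIJ88Sect3Statements.plaqVar u p * BIJ88Sect3Statements.plaqVar w p := by
  simp only [BIJ88Sect3Statements.plaqVar, map_mul]
  ring

/-- kernel: the plaquette variable of a phase field is the phase of the curl, `u′(∂p) = e^{ie₀(∂A′)(p)}` (`∂` =
`LatticeFieldCalculus.curl 1`). [cite: BalabanImbrieJaffe1988, (3.25) p.269] -/
theorem plaqVar_phase (e₀ : ℝ) (A : PBond P j → ℝ) (p : Plaq P j) :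
    BIJ88Sect3Statements.plaqVar (phase e₀ A) p = exp (I * (e₀ * LatticeFieldCalculus.curl 1 A p : ℝ)) := by
  simp only [BIJ88Sect3Statements.plaqVar, phase, LatticeFieldCalculus.curl, one_smul, ← exp_conj, map_mul, conj_I, conj_ofReal,
    ← exp_add]
  congr 1
  push_cast
  ring

/-- kernel: the principal-branch field strength (3.26) of `e^{ie₀θ}` is `θ` when `|e₀θ| < π`.
[cite: BalabanImbrieJaffe1988, (3.26) p.269] -/
theorem fieldStrength_exp_of_small {e₀ θ : ℝ} (he : e₀ ≠ 0) (hθ : |e₀ * θ| < Real.pi) :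
    BIJ88Sect3Statements.fieldStrength e₀ (exp (I * (e₀ * θ : ℝ))) = θ := by
  have h1 : -Real.pi < (I * (e₀ * θ : ℝ)).im := by
    simp only [mul_im, I_re, I_im, ofReal_re, ofReal_im, zero_mul, one_mul, zero_add]
    linarith [neg_abs_le (e₀ * θ)]
  have h2 : (I * (e₀ * θ : ℝ)).im ≤ Real.pi := by
    simp only [mul_im, I_re, I_im, ofReal_re, ofReal_im, zero_mul, one_mul, zero_add]
    linarith [le_abs_self (e₀ * θ)]
  rw [BIJ88Sect3Statements.fieldStrength, log_exp h1 h2]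
  have he' : (e₀ : ℂ) ≠ 0 := ofReal_ne_zero.2 he
  field_simp
  push_cast
  ring

/-- The data of (3.25): on every plaquette of `Λ₁**` the surface-average field `w = Q^{s*}v` has plaquette variable
`e^{ie₀L^{−2}(Q^{e*}f)(p)}` — the identity of [2] = [BalabanImbrieJaffe1985] (2.19) (row C1.Eq2.19), here a HYPOTHESIS on the data
`w`, `g = Q^{e*}f`. [cite: BalabanImbrieJaffe1988, (3.25) p.269] -/
def SurfacePhase (Λ₁pp : Finset (Plaq P j)) (w : PBond P j → ℂ) (e₀ L : ℝ) (g : Plaq P j → ℝ) : Prop :=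
  ∀ p ∈ Λ₁pp, BIJ88Sect3Statements.plaqVar w p = exp (I * (e₀ * (L ^ (-(2 : ℤ)) * g p) : ℝ))

/-- The content of (3.25) pointwise: for `u = u′·w` with `u′ = e^{ie₀A′}`, `w(∂p) = e^{ie₀L^{−2}g(p)}` on `Λ₁**` and small fields
`|e₀((∂A′)(p) + L^{−2}g(p))| < π`, the field strength is `f^{(0)}(p) = (∂A′)(p) + L^{−2}(Q^{e*}f)(p)`.
[cite: BalabanImbrieJaffe1988, (3.25) p.269] -/
theorem fieldStrength_u324 {Λ₁star : Finset (PBond P j)} {Λ₁pp : Finset (Plaq P j)} {w : PBond P j → ℂ} {e₀ L : ℝ}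
    {g : Plaq P j → ℝ} (he : e₀ ≠ 0) (hw : SurfacePhase Λ₁pp w e₀ L g)
    (hpp : ∀ p ∈ Λ₁pp, (⟨p.src, p.μ⟩ : PBond P j) ∈ Λ₁star ∧ (⟨p.src.shift p.μ, p.ν⟩ : PBond P j) ∈ Λ₁star ∧
      (⟨p.src.shift p.ν, p.μ⟩ : PBond P j) ∈ Λ₁star ∧ (⟨p.src, p.ν⟩ : PBond P j) ∈ Λ₁star)
    (A' : PBond P j → ℝ) {p : Plaq P j} (hp : p ∈ Λ₁pp)
    (hsmall : |e₀ * (LatticeFieldCalculus.curl 1 A' p + L ^ (-(2 : ℤ)) * g p)| < Real.pi) :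
    BIJ88Sect3Statements.fieldStrength e₀ (BIJ88Sect3Statements.plaqVar (u324 Λ₁star (phase e₀ A') w) p) =
      ((LatticeFieldCalculus.curl 1 A' p + L ^ (-(2 : ℤ)) * g p : ℝ) : ℂ) := by
  obtain ⟨h1, h2, h3, h4⟩ := hpp p hp
  have hprod : BIJ88Sect3Statements.plaqVar (u324 Λ₁star (phase e₀ A') w) p =
      BIJ88Sect3Statements.plaqVar (fun b => phase e₀ A' b * w b) p := by
    simp only [BIJ88Sect3Statements.plaqVar, u324_of_mem _ _ h1, u324_of_mem _ _ h2, u324_of_mem _ _ h3, u324_of_mem _ _ h4]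
  have harg : I * ((e₀ * LatticeFieldCalculus.curl 1 A' p : ℝ) : ℂ) + I * ((e₀ * (L ^ (-(2 : ℤ)) * g p) : ℝ) : ℂ) =
      I * ((e₀ * (LatticeFieldCalculus.curl 1 A' p + L ^ (-(2 : ℤ)) * g p) : ℝ) : ℂ) := by
    push_cast
    ring
  rw [hprod, plaqVar_mul, plaqVar_phase, hw p hp, ← exp_add, harg, fieldStrength_exp_of_small he hsmall]

/-- The quadratic form `⟨Λf, Λf⟩ = Σ_{p ∈ Λ} f(p)²` of a real plaquette function over a plaquette set (unit lattice, unit weights).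
[cite: BalabanImbrieJaffe1988, (3.25) p.269] -/
def plaqForm (Λpp : Finset (Plaq P j)) (f : Plaq P j → ℝ) : ℝ := ∑ p ∈ Λpp, f p ^ 2

/-- **(3.25)** p. 269 [PDF 13], verbatim: *"The quadratic form for the gauge field in Λ₁^{(0)**} is ⟨Λ₁^{(0)**}f^{(0)}, Λ₁^{(0)**}f^{(0)}⟩
= ⟨Λ₁^{(0)**}(∂A′ + L^{−2}Q^{e*}f), Λ₁^{(0)**}(∂A′ + L^{−2}Q^{e*}f)⟩, (3.25)"* — PROVED for the translated field (3.24) with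
`u′ = e^{ie₀A′}`, under the [2] (2.19) surface identity on the data and the small-field hypothesis (principal branch), with
`f^{(0)}(p) = Re (ie₀)⁻¹log u(p)`, `∂ = curl 1`, `g = Q^{e*}f`. [cite: BalabanImbrieJaffe1988, (3.25) p.269] -/
theorem eq325 {Λ₁star : Finset (PBond P j)} {Λ₁pp : Finset (Plaq P j)} {w : PBond P j → ℂ} {e₀ L : ℝ} {g : Plaq P j → ℝ}
    (he : e₀ ≠ 0) (hw : SurfacePhase Λ₁pp w e₀ L g)
    (hpp : ∀ p ∈ Λ₁pp, (⟨p.src, p.μ⟩ : PBond P j) ∈ Λ₁star ∧ (⟨p.src.shift p.μ, p.ν⟩ : PBond P j) ∈ Λ₁star ∧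
      (⟨p.src.shift p.ν, p.μ⟩ : PBond P j) ∈ Λ₁star ∧ (⟨p.src, p.ν⟩ : PBond P j) ∈ Λ₁star)
    (A' : PBond P j → ℝ) (hsmall : ∀ p ∈ Λ₁pp, |e₀ * (LatticeFieldCalculus.curl 1 A' p + L ^ (-(2 : ℤ)) * g p)| < Real.pi) :
    plaqForm Λ₁pp (fun p => (BIJ88Sect3Statements.fieldStrength e₀
        (BIJ88Sect3Statements.plaqVar (u324 Λ₁star (phase e₀ A') w) p)).re) =
      plaqForm Λ₁pp (fun p => LatticeFieldCalculus.curl 1 A' p + L ^ (-(2 : ℤ)) * g p) := by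
  refine sum_congr rfl fun p hp => ?_
  dsimp only
  rw [fieldStrength_u324 he hw hpp A' hp (hsmall p hp), ofReal_re]

/-! ## (3.29)–(3.31): the scalar-field forms, their remainder, the scalar translation, the basic forms -/

/-- The scalar field forms of the left side of (3.29) as a function of the gauge field `u`: `½aL^{−2}⟨ψ − Q(u)φ, ψ − Q(u)φ⟩ +
½⟨φ, −Δ_uφ⟩`, over the operator data `Q` (the covariant block average `Q(u)φ`, [2] Chap. 2) and `lapForm` (`⟨φ, −Δ_uφ⟩`, (3.3)).
[cite: BalabanImbrieJaffe1988, (3.29) p.270] -/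
def scalarForms (a L : ℝ) (Q : (PBond P j → ℂ) → (Balaban1983to89.Site P j → ℂ) → Balaban1983to89.Site P (j + 1) → ℂ)
    (lapForm : (PBond P j → ℂ) → (Balaban1983to89.Site P j → ℂ) → ℝ) (u : PBond P j → ℂ)
    (φ : Balaban1983to89.Site P j → ℂ) (ψ : Balaban1983to89.Site P (j + 1) → ℂ) : ℝ :=
  (1 / 2) * a * L ^ (-(2 : ℤ)) * (∑ y : Balaban1983to89.Site P (j + 1), ‖ψ y - Q u φ y‖ ^ 2) + (1 / 2) * lapForm u φ

/-- **(3.29)** p. 270 [PDF 14], verbatim: *"The expansion yields for the scalar field forms ½aL^{−2}⟨ψ − Q(u)φ, ψ − Q(u)φ⟩ +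
½⟨φ, −Δ_uφ⟩ = ½aL^{−2}⟨ψ − Q(u₁)φ, ψ − Q(u₁)φ⟩ + ½⟨φ, −Δ_{u₁}φ⟩ + R^{(0)}(u₁, θ₀A^{(0)}) + Σ_□ W₁^{(0)}(□), (3.29) where R^{(0)}
contains the first n̄ orders in A^{(0)} (or in e₀) and the higher order, irrelevant, local terms are incorporated in W₁^{(0)}(□)"* —
the display DEFINES the expansion terms `R^{(0)} + Σ_□W₁^{(0)}(□)` collectively as the difference of the forms at `u` and at the
background `u₁` (their split by order in `A^{(0)}` is the deferred perturbation expansion). [cite: BalabanImbrieJaffe1988, (3.29) p.270] -/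
def rem329 (a L : ℝ) (Q : (PBond P j → ℂ) → (Balaban1983to89.Site P j → ℂ) → Balaban1983to89.Site P (j + 1) → ℂ)
    (lapForm : (PBond P j → ℂ) → (Balaban1983to89.Site P j → ℂ) → ℝ) (u u₁ : PBond P j → ℂ)
    (φ : Balaban1983to89.Site P j → ℂ) (ψ : Balaban1983to89.Site P (j + 1) → ℂ) : ℝ :=
  scalarForms a L Q lapForm u φ ψ - scalarForms a L Q lapForm u₁ φ ψ

/-- (3.29) as the identity it displays: forms at `u` = forms at `u₁` + (R^{(0)} + ΣW₁^{(0)}). [cite: BalabanImbrieJaffe1988, (3.29) p.270] -/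
theorem eq329 (a L : ℝ) (Q : (PBond P j → ℂ) → (Balaban1983to89.Site P j → ℂ) → Balaban1983to89.Site P (j + 1) → ℂ)
    (lapForm : (PBond P j → ℂ) → (Balaban1983to89.Site P j → ℂ) → ℝ) (u u₁ : PBond P j → ℂ)
    (φ : Balaban1983to89.Site P j → ℂ) (ψ : Balaban1983to89.Site P (j + 1) → ℂ) :
    scalarForms a L Q lapForm u φ ψ = scalarForms a L Q lapForm u₁ φ ψ + rem329 a L Q lapForm u u₁ φ ψ := by
  simp [rem329]

/-- **(3.30)** p. 270 [PDF 14], verbatim: *"The next step is a scalar field translation to remove the term linear in φ in (3.29).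
Again we make a local translation, φ = φ^{(0)} + aL^{−2}Λ₇^{(0)}C^{(0)}_{loc}(u₁)Q*(u₁)ψ. (3.30)"* — over the site function
`corr = C^{(0)}_{loc}(u₁)Q*(u₁)ψ` (data) and the site set `Λ₇`. [cite: BalabanImbrieJaffe1988, (3.30) p.270] -/
def phi330 (Λ₇ : Finset (Balaban1983to89.Site P j)) (a L : ℝ) (φ0 corr : Balaban1983to89.Site P j → ℂ) : Balaban1983to89.Site P j → ℂ :=
  fun x => φ0 x + if x ∈ Λ₇ then ((a * L ^ (-(2 : ℤ)) : ℝ) : ℂ) * corr x else 0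

/-- (3.30) outside `Λ₇`: no translation (*"local translation"*). [cite: BalabanImbrieJaffe1988, (3.30) p.270] -/
theorem phi330_of_not_mem {Λ₇ : Finset (Balaban1983to89.Site P j)} (a L : ℝ) (φ0 corr : Balaban1983to89.Site P j → ℂ)
    {x : Balaban1983to89.Site P j} (hx : x ∉ Λ₇) : phi330 Λ₇ a L φ0 corr x = φ0 x := by
  simp [phi330, hx]

/-- **(3.31)** p. 270 [PDF 14], verbatim: *"we obtain the basic quadratic forms in φ^{(0)} and ψ: ½⟨φ^{(0)}, (−Δ_{u₁} +
aL^{−2}Q(u₁)*Q(u₁))φ^{(0)}⟩ + ½⟨Λ₈^{(0)′}ψ, Δ^L_{1,loc}(u₁)Λ₈^{(0)′}ψ⟩. (3.31)"* — over the kernels of `−Δ_{u₁} + aL^{−2}Q(u₁)*Q(u₁)`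
(sites of `T₁`) and of `Δ^L_{1,loc}(u₁)` ((2.34), block sites), both at the background `u₁`, and the block-site set `Λ₈′`.
[cite: BalabanImbrieJaffe1988, (3.31) p.270] -/
def basicForms331 (M : Balaban1983to89.Site P j → Balaban1983to89.Site P j → ℂ)
    (Δloc : Balaban1983to89.Site P (j + 1) → Balaban1983to89.Site P (j + 1) → ℂ) (Λ₈' : Finset (Balaban1983to89.Site P (j + 1)))
    (φ0 : Balaban1983to89.Site P j → ℂ) (ψ : Balaban1983to89.Site P (j + 1) → ℂ) : ℝ :=
  (1 / 2) * (∑ x : Balaban1983to89.Site P j, ∑ y : Balaban1983to89.Site P j, (starRingEnd ℂ) (φ0 x) * M x y * φ0 y).re +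
    (1 / 2) * (∑ x ∈ Λ₈', ∑ y ∈ Λ₈', (starRingEnd ℂ) (ψ x) * Δloc x y * ψ y).re

end

end Literature.MathematicalPhysics.QuantumFieldTheory.BalabanImbrieJaffe1984to88.BIJ88Sect3Translations
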